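import Summits.CriticalPhenomena.PercolationContinuityZ3.Theorems.Transplant.SkelFrmFromBParamsKitA
import Summits.CriticalPhenomena.PercolationContinuityZ3.Theorems.Transplant.SkelFrmBParamsKitA
import Summits.CriticalPhenomena.PercolationContinuityZ3.Theorems.Transplant.SkelNegBParamsKitA
import Summits.CriticalPhenomena.PercolationContinuityZ3.Theorems.Transplant.SkelFrmFromBParamsB
import Summits.CriticalPhenomena.PercolationContinuityZ3.Theorems.Transplant.SkelFrmBParamsB
import Summits.CriticalPhenomena.PercolationContinuityZ3.Theorems.Transplant.SkelNegBParamsB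
import Summits.CriticalPhenomena.PercolationContinuityZ3.Theorems.Transplant.SkelNegBChoiceAll
import Summits.CriticalPhenomena.PercolationContinuityZ3.Theorems.Transplant.SkelFrmFrom1SlotTypes
import Summits.CriticalPhenomena.PercolationContinuityZ3.Theorems.Transplant.SkelFrm1SlotTypes
import Summits.CriticalPhenomena.PercolationContinuityZ3.Theorems.Transplant.SkelFrmFrom1ParamsPO
import Summits.CriticalPhenomena.PercolationContinuityZ3.Theorems.Transplant.SkelFrm1ParamsPO
import Summits.CriticalPhenomena.PercolationContinuityZ3.Theorems.Transplant.SkelFrmFrom1ParamsLBL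
import Summits.CriticalPhenomena.PercolationContinuityZ3.Theorems.Transplant.SkelFrm1ParamsLBL
import Summits.CriticalPhenomena.PercolationContinuityZ3.Theorems.Transplant.SkelFrmFrom1ParamsLF
import Summits.CriticalPhenomena.PercolationContinuityZ3.Theorems.Transplant.SkelFrm1ParamsLF
import Summits.CriticalPhenomena.PercolationContinuityZ3.Theorems.Transplant.SkelFrmFrom1ParamsLO
import Summits.CriticalPhenomena.PercolationContinuityZ3.Theorems.Transplant.SkelFrm1ParamsLO
import Summits.CriticalPhenomena.PercolationContinuityZ3.Theorems.Transplant.SkelFrmFromBParamsLF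
import Summits.CriticalPhenomena.PercolationContinuityZ3.Theorems.Transplant.SkelFrmBParamsLF
import Summits.CriticalPhenomena.PercolationContinuityZ3.Theorems.Transplant.SkelFrmFromBParamsLO
import Summits.CriticalPhenomena.PercolationContinuityZ3.Theorems.Transplant.SkelFrmBParamsLO
import Summits.CriticalPhenomena.PercolationContinuityZ3.Theorems.Transplant.SkelNegBParamsSlotsR
import Summits.CriticalPhenomena.PercolationContinuityZ3.Theorems.Transplant.PlanarSkeletonFrmFromDefs
import Summits.CriticalPhenomena.PercolationContinuityZ3.Theorems.Transplant.PlanarSkeletonFrmDefs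
import Summits.CriticalPhenomena.PercolationContinuityZ3.Theorems.Transplant.SkelPhiStepIDataNS
import HarnessLib
import Summits.CriticalPhenomena.PercolationContinuityZ3.Theorems.Transplant.SkelFrmBParamsSlotsR
/-!
# U-WAVE PORT (RULING D-U, lead g21 2026-08-26; WAVE-U-MANIFEST v3.1 row «SkelFrmBParamsSlotsR» ↦ «SkelFrmFromBParamsSlotsR») of the tree module
# `Transplant/SkelFrmBParamsSlotsR` onto the carrier `PlanarSkeletonFrmFrom` (frames only, cylinders connected from width `ℓ₀` on)

ORIGINAL TITLE: N2 (frames-only node `SamePDropOfSkeletonFrmFrom₁`, OPEN) params column over `PlanarSkeletonFrm` — (ζ″) ledger, shape (B′) of record ((R-14)):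

builds on p205010 (kernel theorem, internal audit signed; external expert review pending) — nothing in this file uses p205010; NOTHING is claimed about the
OPEN node U `SamePDropOfSkeletonFrmFrom₁` (nor U_s / the end state).  Lane `prim-bschramm`, seat `prim-bschramm-stmt` gen 26 (port pen, RULING M-11 family P-stmt; tool = p3-g26's port_u.py of record, registry-driven inputs); helper file
(`--supports stmt-CriticalPhenomena-4575 --as helper`).  PORT RULES r1–r4 of RULING D-U: declaration order and proof texts are those of the original,
byte-identical except (i) the carrier token `PlanarSkeletonFrm ↦ PlanarSkeletonFrmFrom` (binders, `namespace`/`end` lines, qualified names of twinned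
declarations), (ii) carrier-FREE declarations of the original (φ-level `Skelφ…` blocks and namespace-only arithmetic residents) are NOT re-declared —
this file imports the original and `export`s the twin-free residents (POLICY T / treatment (m1)); residents whose statement mentions a twinned
constant are copied, (iii) every carrier-binding declaration keeps its explicit binder `(Φ : PlanarSkeletonFrmFrom G)` in its own signature (r2).  Docstrings and citations are the original's.
-/

noncomputable section

open scoped Classical

namespace Summit.CriticalPhenomena.PercolationContinuityZ3.Theorems.Transplant

namespace PlanarSkeletonFrmFrom

namespace NegB

open MeasureTheory Literature.Probability.Percolation Literature.Probability.LatticeModels SimpleGraph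
open SkelConc (Consts)
open Skelφ (oriφ trφ)
open Skelφ.StepI (DataN OutO)
open Neg

/-! ## §1 The bridge slot values at `R′ := RA'` -/

section BridgeR

/-- **THE BRIDGE CLEARANCE OF RECORD** `b := Δ₀ := D.k + 2·R′ + 1` at `R′ := RA'` (p3-g9's exact (R-F2) floor, read AFTER the kit block). [this work] -/
def bR (κ : Consts) {V : Type} [Countable V] {G : SimpleGraph V} [G.LocallyFinite] (Φ : PlanarSkeletonFrmFrom G) (t : V) (p : unitInterval) (D : Skelφ.StepI.DataNS V) : ℕ := D.k + 2 * RA' κ Φ t p D + 1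

/-- **THE BRIDGE ZONE-INDEX FLOOR OF RECORD** `mb := max (2Δ₀ + 26) (22·M_u + 58)`. [this work] -/
def mbR (κ : Consts) {V : Type} [Countable V] {G : SimpleGraph V} [G.LocallyFinite] (Φ : PlanarSkeletonFrmFrom G) (t : V) (p : unitInterval) (D : Skelφ.StepI.DataNS V) : ℕ := max (2 * bR κ Φ t p D + 26) (22 * Mu D + 58)

/-- `bR = D.k + 2·RA' + 1` (by `rfl`) and `D.k ≤ bR`, `2·RA' + 1 ≤ bR`. [folklore] -/
theorem bR_eq (κ : Consts) {V : Type} [Countable V] {G : SimpleGraph V} [G.LocallyFinite] (Φ : PlanarSkeletonFrmFrom G) (t : V) (p : unitInterval) (D : Skelφ.StepI.DataNS V) : bR κ Φ t p D = D.k + 2 * RA' κ Φ t p D + 1 ∧ D.k ≤ bR κ Φ t p D ∧ 2 * RA' κ Φ t p D + 1 ≤ bR κ Φ t p D :=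
  ⟨rfl, by unfold bR; omega, by unfold bR; omega⟩

/-- `2·bR + 26 ≤ mbR` and `22·M_u + 58 ≤ mbR`. [folklore] -/
theorem mbR_floors (κ : Consts) {V : Type} [Countable V] {G : SimpleGraph V} [G.LocallyFinite] (Φ : PlanarSkeletonFrmFrom G) (t : V) (p : unitInterval) (D : Skelφ.StepI.DataNS V) : 2 * bR κ Φ t p D + 26 ≤ mbR κ Φ t p D ∧ 22 * Mu D + 58 ≤ mbR κ Φ t p D := ⟨le_max_left _ _, le_max_right _ _⟩

/-- The bridge zone index at the slot values `M_b := MB D mbR`. [this work] -/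
abbrev MBR (κ : Consts) {V : Type} [Countable V] {G : SimpleGraph V} [G.LocallyFinite] (Φ : PlanarSkeletonFrmFrom G) (t : V) (p : unitInterval) (D : Skelφ.StepI.DataNS V) : ℕ := MB D (mbR κ Φ t p D)

/-- The bridge width at the slot values `n_b := nB D mbR bR`. [this work] -/
abbrev nBR (κ : Consts) {V : Type} [Countable V] {G : SimpleGraph V} [G.LocallyFinite] (Φ : PlanarSkeletonFrmFrom G) (t : V) (p : unitInterval) (D : Skelφ.StepI.DataNS V) : ℕ := nB D (mbR κ Φ t p D) (bR κ Φ t p D)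

/-- The bridge shear at the slot values. [this work] -/
abbrev hBR (κ : Consts) {V : Type} [Countable V] {G : SimpleGraph V} [G.LocallyFinite] (Φ : PlanarSkeletonFrmFrom G) (t : V) (p : unitInterval) (D : Skelφ.StepI.DataNS V) : ℤ := hB t D (mbR κ Φ t p D) (bR κ Φ t p D)

/-- The bridge half-length at the slot values. [this work] -/
abbrev ℓBR (κ : Consts) {V : Type} [Countable V] {G : SimpleGraph V} [G.LocallyFinite] (Φ : PlanarSkeletonFrmFrom G) (t : V) (p : unitInterval) (D : Skelφ.StepI.DataNS V) : ℕ := ℓB t D (mbR κ Φ t p D) (bR κ Φ t p D)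

/-- The bridge split point at the slot values. [this work] -/
abbrev vBR (κ : Consts) {V : Type} [Countable V] {G : SimpleGraph V} [G.LocallyFinite] (Φ : PlanarSkeletonFrmFrom G) (t : V) (p : unitInterval) (D : Skelφ.StepI.DataNS V) : ℤ := vB t D (mbR κ Φ t p D) (bR κ Φ t p D)

/-- **The bridge pair at the slot values is admissible.** [folklore] -/
theorem bridgeR_adm (κ : Consts) {V : Type} [Countable V] {G : SimpleGraph V} [G.LocallyFinite] (Φ : PlanarSkeletonFrmFrom G) (t : V) (p : unitInterval) (D : Skelφ.StepI.DataNS V) : D.M₀ ≤ (MBR κ Φ t p D, nBR κ Φ t p D).1 ∧ D.n₁ (MBR κ Φ t p D, nBR κ Φ t p D).1 ≤ (MBR κ Φ t p D, nBR κ Φ t p D).2 :=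
  bridge_adm D _ _

/-- **(R-F2) at the values**: `bR ≤ n_b`, together with `M_b < n_b` and `M_b + bR + 2 + ρz ≤ n_b`. [folklore] -/
theorem RF2_R (κ : Consts) {V : Type} [Countable V] {G : SimpleGraph V} [G.LocallyFinite] (Φ : PlanarSkeletonFrmFrom G) (t : V) (p : unitInterval) (D : Skelφ.StepI.DataNS V) : bR κ Φ t p D ≤ nBR κ Φ t p D ∧ MBR κ Φ t p D < nBR κ Φ t p D ∧ MBR κ Φ t p D + bR κ Φ t p D + 2 + ρz D ≤ nBR κ Φ t p D :=
  ⟨(nB_facts D _ _).2.2.1, (nB_facts D _ _).2.1, (nB_facts D _ _).2.2.2⟩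

/-- **The zone-index floors at the values**: `2·bR + 26 ≤ M_b`, `22·M_u + 58 ≤ M_b`, `M_kit < M_b`, `M_u ≤ M_b`. [folklore] -/
theorem MB_floorsR (κ : Consts) {V : Type} [Countable V] {G : SimpleGraph V} [G.LocallyFinite] (Φ : PlanarSkeletonFrmFrom G) (t : V) (p : unitInterval) (D : Skelφ.StepI.DataNS V) : 2 * bR κ Φ t p D + 26 ≤ MBR κ Φ t p D ∧ 22 * Mu D + 58 ≤ MBR κ Φ t p D ∧ Mkit D < MBR κ Φ t p D ∧ Mu D ≤ MBR κ Φ t p D := by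
  have h1 := (MB_facts D (mbR κ Φ t p D)).2.1
  have h2 := mbR_floors κ Φ t p D
  refine ⟨h2.1.trans h1, h2.2.trans h1, ?_, (MB_facts D _).1⟩
  show Mkit D < MB D (mbR κ Φ t p D)
  unfold Mkit; omega

/-- **The one-stride room at the values**: from the bridge clause (any map `ψ`), `2·bR + 27 ≤ ℓ_b` (p3-g9 15:55:22Z: `ℓ_b ≥ 2Δ₀ + 25` suffices). [folklore] -/
theorem ℓBR_ge (κ : Consts) {V : Type} [Countable V] {G : SimpleGraph V} [G.LocallyFinite] (Φ : PlanarSkeletonFrmFrom G) (t : V) (p : unitInterval) (D : Skelφ.StepI.DataNS V) (ψ : V → Site 2) (hE : D.EqGeom G ψ t (MBR κ Φ t p D) (nBR κ Φ t p D)) : 2 * bR κ Φ t p D + 27 ≤ ℓBR κ Φ t p D := by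
  have h1 := ℓB_ge t D (mbR κ Φ t p D) (bR κ Φ t p D) ψ hE
  have h2 := (mbR_floors κ Φ t p D).1
  show _ ≤ ℓB t D (mbR κ Φ t p D) (bR κ Φ t p D)
  omega

end BridgeR

/-! ## §1b The first kit level against the apron's clamp (p1-g11 2026-08-21T17:00:06Z) -/

section Levels

/-- **`tanOff apron.ℓs apron.M ≤ j₀`** (the kit levels start at the tangential clamp `T₀ = D_sh + M`, so `hwide/hdw/hDw` hold on every level `j ∈ [j₀, j₁]` by `levels_wide`).
[folklore] -/
theorem j₀A_ge {V : Type} {G : SimpleGraph V} [G.LocallyFinite] (Φ : PlanarSkeletonFrmFrom G) (t : V) (D : Skelφ.StepI.DataNS V) (A : ℤ) (r₀ : ℕ) : SkelI.tanOff (apron Φ t D A r₀).ℓs (apron Φ t D A r₀).M ≤ j₀A t D := by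
  rw [tanOff_apron]; rfl

/-- The level range by name: `j₀ = T₀`, `j₀ ≤ j → tanOff ℓs M ≤ j`. [folklore] -/
theorem le_of_j₀A_le {V : Type} {G : SimpleGraph V} [G.LocallyFinite] (Φ : PlanarSkeletonFrmFrom G) (t : V) (D : Skelφ.StepI.DataNS V) (A : ℤ) (r₀ : ℕ) {j : ℕ} (hj : j₀A t D ≤ j) : SkelI.tanOff (apron Φ t D A r₀).ℓs (apron Φ t D A r₀).M ≤ j :=
  (j₀A_ge Φ t D A r₀).trans hj

end Levels

/-! ## §2 The kit pair, oriented -/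

section KitO

/-- **The kit pair's orientation bit** `o_kit := ori t M_kit n_kit` (values at the merged record). [this work] -/
def oK {V : Type} (t : V) (D : Skelφ.StepI.DataNS V) (DT : DataN V) (ori : V → ℕ → ℕ → Bool) : Bool := ori t (Mkit (D.orient DT ori)) (nKit (D.orient DT ori))

/-- **The planar map the KIT PIECES live in**: `Φ.φ` or its transpose (located stmt-g14 (L3): need not be the long pair's `φL`). [this work] -/
def φK {V : Type} {G : SimpleGraph V} [G.LocallyFinite] (Φ : PlanarSkeletonFrmFrom G) (t : V) (D : Skelφ.StepI.DataNS V) (DT : DataN V) (ori : V → ℕ → ℕ → Bool) : V → Site 2 := oriφ Φ.φ (oK t D DT ori)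

/-- `φK` is 1-Lipschitz. [folklore] -/
theorem lip_φK {V : Type} {G : SimpleGraph V} [G.LocallyFinite] (Φ : PlanarSkeletonFrmFrom G) (t : V) (D : Skelφ.StepI.DataNS V) (DT : DataN V) (ori : V → ℕ → ℕ → Bool) : Skelφ.Lip G (φK Φ t D DT ori) := Skelφ.lip_oriφ Φ.lip _

/-- `φK` has unit steps. [folklore] -/
theorem steps_φK {V : Type} {G : SimpleGraph V} [G.LocallyFinite] (Φ : PlanarSkeletonFrmFrom G) (t : V) (D : Skelφ.StepI.DataNS V) (DT : DataN V) (ori : V → ℕ → ℕ → Bool) : Skelφ.Steps G (φK Φ t D DT ori) := Skelφ.steps_oriφ Φ.step _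

/-- **THE KIT PAIR's CLAUSE FROM `FactsO`**: the merged record's geometric clause at `(M_kit, n_kit)` FOR THE ORIENTED MAP `φK`, and `|h_kit| ≤ 10·n_kit`. [this work] -/
theorem clauseK_of_factsO {V : Type} {G : SimpleGraph V} [G.LocallyFinite] (Φ : PlanarSkeletonFrmFrom G) (t : V) (D : Skelφ.StepI.DataNS V) (DT : DataN V) (ori : V → ℕ → ℕ → Bool) (hR : DT.R = D.R)
    (hfacts : ∀ M, D.M₀ ≤ M → ∀ n, D.n₁ M ≤ n →
      (ori t M n = true → D.EqGeom G Φ.φ t M n ∧ (D.hgt t M n).natAbs ≤ 10 * n) ∧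
      (ori t M n = false → DT.EqGeom G (trφ Φ.φ) t M n ∧ (DT.hgt t M n).natAbs ≤ 10 * n)) :
    (D.orient DT ori).EqGeom G (φK Φ t D DT ori) t (Mkit (D.orient DT ori)) (nKit (D.orient DT ori)) ∧
      (hKit t (D.orient DT ori)).natAbs ≤ 10 * nKit (D.orient DT ori) :=
  Skelφ.StepI.orient_clause_all hR hfacts _ (Mkit_facts _).2.2 _ (nKit_facts _).1

/-- **The kit pair's geometric facts unpacked** (ℤ shapes), for ANY map: `M_kit < n_kit`, `M_kit < ℓ_kit`, `|v_kit| ≤ n_kit`, the layer inequality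
`(M_kit+1)(n_kit+|h_kit|) ≤ n_kit(ℓ_kit+1)`. [folklore] -/
theorem eqNumK_of_eqGeom {V : Type} {G : SimpleGraph V} [G.LocallyFinite] (t : V) (D : Skelφ.StepI.DataNS V) (ψ : V → Site 2) (hE : D.EqGeom G ψ t (PlanarSkeletonFrmFrom.NegB.Mkit D) (nKit D)) :
    Mkit D < nKit D ∧ Mkit D < ℓKit t D ∧ |vKit t D| ≤ (nKit D : ℤ) ∧
      ((Mkit D : ℤ) + 1) * ((nKit D : ℤ) + |hKit t D|) ≤ (nKit D : ℤ) * ((ℓKit t D : ℤ) + 1) :=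
  eqGeom_num_of t D ψ hE

/-- **p1's level-side exit floor at the kit pair** (`ℓ ≥ 22·M_z + 57`, (L) 2026-08-21T15:35:14Z): `22·M_u + 58 ≤ ℓ_kit`, from `M_kit < ℓ_kit`. [folklore] -/
theorem ℓKit_ge {V : Type} {G : SimpleGraph V} [G.LocallyFinite] (t : V) (D : Skelφ.StepI.DataNS V) (ψ : V → Site 2) (hE : D.EqGeom G ψ t (Mkit D) (nKit D)) : 22 * Mu D + 58 ≤ ℓKit t D := by
  have h := (eqNumK_of_eqGeom t D ψ hE).2.1
  unfold Mkit at h; omega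

end KitO

end NegB
end PlanarSkeletonFrmFrom
end Summit.CriticalPhenomena.PercolationContinuityZ3.Theorems.Transplant
end
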